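import Mathlib

/-!
# SoloBlind artefact 6 — rank-one interlacing in variational form

Context (soloist `solo-RiemannHypothesis-blind`, claim C30).  On a window `[-a, a]` the Weil quadratic
form restricted to EVEN test functions reads `Q = Q₀ + 2 |C⟩⟨C|`, where `Q₀` (Weil form minus its polar
part) is a Markov form and `C = cosh(t/2)`; on ODD functions `Q = Q₀ - 2 |S⟩⟨S|`, `S = sinh(t/2)`.
The elementary fact recorded here is the variational core of Cauchy interlacing for a rank-one
perturbation: every 2-plane contains a non-zero vector killed by the functional `c = ⟨C, ·⟩`, on which
`Q` and `Q₀` agree.  Consequently the bottom of `Q` is at most the sup of the `Q₀`-Rayleigh quotient over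
ANY 2-plane (hence at most the second min–max level of `Q₀`), and the sup of the `Q₀`-quotient over a
plane is at most that of `Q` (so the second min–max level of `Q₀` is at most that of `Q`): the pin
`λ_e ≤ E₁(Q₀^{ev}) ≤ ε₁^{ev}` of the report, window by window.

Everything is stated over an arbitrary real vector space with an ARBITRARY "energy" `B : V → ℝ` and an
arbitrary "mass" `N : V → ℝ` (no bilinearity, no inner product is used — only linearity of `c`), so the
statements apply verbatim to closed semibounded forms on a common form domain.  Mathlib only.
-/

namespace Summit.RiemannHypothesis.RiemannHypothesis.Theorems

variable {V : Type*} [AddCommGroup V] [Module ℝ V]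

/-- Every 2-plane meets the kernel of a linear functional non-trivially (coefficients form). -/
theorem soloBlind_plane_meets_ker (c : V →ₗ[ℝ] ℝ) (φ₁ φ₂ : V) :
    ∃ s t : ℝ, (s ≠ 0 ∨ t ≠ 0) ∧ c (s • φ₁ + t • φ₂) = 0 := by
  by_cases h : c φ₁ = 0
  · exact ⟨1, 0, Or.inl one_ne_zero, by simp [h]⟩
  · refine ⟨c φ₂, -(c φ₁), Or.inr (neg_ne_zero.mpr h), ?_⟩
    simp [map_add, map_smul, smul_eq_mul]
    ring

/-- INTERLACING PIN, lower half.  If `B + 2 c²` is bounded below by `lam • N` everywhere (think: `lam` =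
bottom of the perturbed form) and `B ≤ M • N` on a 2-plane on which `N > 0` off the origin (think: `M` =
the max of the unperturbed Rayleigh quotient over that plane), then `lam ≤ M`.  Taking the infimum over
planes: bottom of `B + 2c²` ≤ second min–max level of `B`. -/
theorem soloBlind_rankOne_pin_lower (B N : V → ℝ) (c : V →ₗ[ℝ] ℝ) (φ₁ φ₂ : V) (lam M : ℝ)
    (hB' : ∀ v : V, lam * N v ≤ B v + 2 * (c v) ^ 2)
    (hW : ∀ s t : ℝ, B (s • φ₁ + t • φ₂) ≤ M * N (s • φ₁ + t • φ₂))
    (hN : ∀ s t : ℝ, (s ≠ 0 ∨ t ≠ 0) → 0 < N (s • φ₁ + t • φ₂)) :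
    lam ≤ M := by
  obtain ⟨s, t, hst, hc⟩ := soloBlind_plane_meets_ker c φ₁ φ₂
  have h1 := hB' (s • φ₁ + t • φ₂)
  have h2 := hW s t
  have h3 := hN s t hst
  rw [hc] at h1
  have h4 : lam * N (s • φ₁ + t • φ₂) ≤ M * N (s • φ₁ + t • φ₂) := by linarith
  exact le_of_mul_le_mul_right h4 h3

/-- INTERLACING PIN, upper half (monotonicity): a plane bound for `B + 2c²` is a plane bound for `B`.
Taking the infimum over planes: second min–max level of `B` ≤ that of `B + 2c²`. -/
theorem soloBlind_rankOne_pin_upper (B N : V → ℝ) (c : V →ₗ[ℝ] ℝ) (φ₁ φ₂ : V) (M' : ℝ)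
    (hW' : ∀ s t : ℝ, B (s • φ₁ + t • φ₂) + 2 * (c (s • φ₁ + t • φ₂)) ^ 2 ≤ M' * N (s • φ₁ + t • φ₂)) :
    ∀ s t : ℝ, B (s • φ₁ + t • φ₂) ≤ M' * N (s • φ₁ + t • φ₂) := by
  intro s t
  have h := hW' s t
  nlinarith [sq_nonneg (c (s • φ₁ + t • φ₂))]

/-- A 2-plane on which `B` is negative (off the origin, as witnessed by `N > 0`) forces a vector of positive
mass on which the rank-one-perturbed energy `B + 2c²` is negative: a positive rank-one term removes at most
one negative direction. -/
theorem soloBlind_rankOne_negative_plane (B N : V → ℝ) (c : V →ₗ[ℝ] ℝ) (φ₁ φ₂ : V)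
    (hneg : ∀ s t : ℝ, (s ≠ 0 ∨ t ≠ 0) → B (s • φ₁ + t • φ₂) < 0)
    (hN : ∀ s t : ℝ, (s ≠ 0 ∨ t ≠ 0) → 0 < N (s • φ₁ + t • φ₂)) :
    ∃ v : V, 0 < N v ∧ B v + 2 * (c v) ^ 2 < 0 := by
  obtain ⟨s, t, hst, hc⟩ := soloBlind_plane_meets_ker c φ₁ φ₂
  exact ⟨s • φ₁ + t • φ₂, hN s t hst, by rw [hc]; simpa using hneg s t hst⟩

/-- Odd sector (`Q = Q₀ - 2|S⟩⟨S|`): non-negativity of the perturbed form says exactly that the unperturbed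
form dominates the rank-one form `2⟨S,·⟩²`; in particular it is itself non-negative. -/
theorem soloBlind_rankOne_odd_dominates (B : V → ℝ) (c : V →ₗ[ℝ] ℝ)
    (h : ∀ v : V, 0 ≤ B v - 2 * (c v) ^ 2) :
    (∀ v : V, 2 * (c v) ^ 2 ≤ B v) ∧ (∀ v : V, 0 ≤ B v) := by
  refine ⟨fun v => by linarith [h v], fun v => ?_⟩
  nlinarith [h v, sq_nonneg (c v)]

end Summit.RiemannHypothesis.RiemannHypothesis.Theorems
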